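import Literature.Geometry.Lorentzian.TrappedZeroEnergyRay
import HarnessLib

/-!
# Zero-energy null geodesics trapped modulo the stationary flow

For a stationary asymptotically flat black hole `𝓑 : StationaryAFBlackHole` (`Stationary.lean`:
a `4`-dimensional spacetime with complete stationary Killing field `T = 𝓑.killing`, asymptotic
region `𝓑.Mext = ⋃ₜ φₜ(Σ_ext)` and domain of outer communications `𝓑.doc = ⟨⟨M_ext⟩⟩`) we define
the predicate

* `StationaryAFBlackHole.HasZeroEnergyRayTrappedModFlow 𝓑`: there are a compact set `S ⊆ ⟨⟨M_ext⟩⟩`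
  and a **maximal** (inextendible, `IsMaximalGeodesicOn` of `Geodesic.lean`) geodesic `γ` of the
  Levi-Civita connection of `𝓑.metric` with (open-interval, non-empty) domain `s ⊆ ℝ` which is
  **null** (`g(γ̇, γ̇) = 0`, `γ̇ ≠ 0`) and of **zero energy** with respect to the stationary Killing
  field (`g(γ̇, T) = 0`) at every parameter, and which is **trapped modulo the stationary flow**:
  `γ t ∈ ⋃_σ φ_σ(S) = stationaryOrbit T S` for every `t ∈ s` — the whole geodesic, in both
  directions, stays inside the `T`-orbit of a compact subset of the d.o.c.

This is the reading, for a stationary spacetime, of the "trapped null geodesics perpendicular to the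
stationary Killing vector-field `T`" of Ionescu–Klainerman, *Rigidity results in general
relativity: a review*, Surveys in Differential Geometry 20 (2015), §1 and §4, whose absence is the
hypothesis of the conjecture stated there (§4, Conclusions: "**Conjecture** (Alexakis–Ionescu–
Klainerman). Any asymptotically flat, regular, stationary vacuum solution … which admits no trapped
null geodesics perpendicular to `T` must be isometric to the exterior part of a non-extremal Kerr
solution"): in a stationary spacetime trapping is a property of the projection of the geodesic to
the space of `T`-orbits (a null geodesic orthogonal to `T` is invariant in character under the flow
`φ_σ`, which acts by isometries fixing `T`), so "stays in a compact region" is taken **modulo the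
flow** — inside `⋃_σ φ_σ(S)`, `S` compact — exactly as the routes `AnalyticityInvadesErgoregion`
(items `ErgoregionAnalyticity`, `LinearZeroModeAnalyticity`, `NonTrappingHawkingRigidity`) and
`BeltLiouville` (items `SmoothHawkingRigidity`, `BeltKillingLiouville`, `BeltReduction`) of the
summit `FinalStateConjecture` inline it, negated, as a hypothesis; the unfolding lemma
`not_hasZeroEnergyRayTrappedModFlow_iff` produces that inlined non-trapping clause verbatim (so that
`rw [not_hasZeroEnergyRayTrappedModFlow_iff]` converts between the two), and
`hasZeroEnergyRayTrappedModFlow_iff` the positive shape.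

## Relation to `HasTrappedZeroEnergyRay`

`TrappedZeroEnergyRay.lean` defines the sibling predicate `StationaryAFBlackHole.HasTrappedZeroEnergyRay`
(route `ZeroEnergyKerrOrBomb`): a future half-ray `γ : [0, ∞) → M` of a zero-energy null geodesic
contained in a compact subset `K` **of spacetime** inside the d.o.c. The two notions differ, and
neither is asserted to imply the other here: compactness in spacetime is the wrong reading where
strong causality holds (no future-inextendible causal curve is totally imprisoned in a compact set on
which strong causality holds, Hawking–Ellis 1973, Prop. 6.4.7), whereas compactness modulo the flow
is what "trapped" means for the geodesic flow of a stationary spacetime (for general null geodesics: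
the photon sphere `{r = 3M} ≅ ℝ_t × S²` of Schwarzschild is compact only after quotienting by the
`t`-translations). The present file records the modulo-flow notion; the half-ray/spacetime notion
is kept unchanged for its own users.

## API (all proved)

* `hasZeroEnergyRayTrappedModFlow_iff`, `not_hasZeroEnergyRayTrappedModFlow_iff` (unfolding; the
  latter is literally the non-trapping hypothesis of the two routes);
* `HasZeroEnergyRayTrappedModFlow.mono_set`: enlarging the compact set `S ⊆ ⟨⟨M_ext⟩⟩` is harmless
  (`stationaryOrbit_mono`);
* `killing_sq_nonneg_of_zeroEnergyNull`: at a point carrying a non-zero null vector orthogonal to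
  `T`, `T` is not timelike, `0 ≤ g(T, T)` (O'Neill 1983, Ch. 5, Lemma 5.26: a causal vector is
  never orthogonal to a timelike one) — zero-energy null rays live in the closed **ergoregion**;
  hence `HasZeroEnergyRayTrappedModFlow.exists_killing_sq_nonneg`: a black hole with a zero-energy
  ray trapped modulo the flow has a non-empty closed ergoregion inside the `T`-orbit of a compact
  subset of its d.o.c.;
* `HasZeroEnergyRayTrappedModFlow.doc_nonempty`;
* `hasZeroEnergyRayTrappedModFlow_of_initial`: the **initial-data criterion** — nullness
  `g(γ̇, γ̇) = 0` and zero energy `g(γ̇, T) = 0` need only be checked at ONE parameter `t₀ ∈ s` of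
  the maximal geodesic, since both scalars are constant along geodesics (constant speed, O'Neill
  1983, Ch. 3, p. 69, and the conservation lemma for the Killing field `T`, O'Neill 1983, Ch. 9,
  Lemma 26, both on the order-connected domain `s`: `val_velocity_eq_of_isGeodesicOn_of_ordConnected`
  and `StationaryAFBlackHole.killingEnergy_eq_of_isGeodesicOn` of `TrappedZeroEnergyRay.lean`).

## References

* A. D. Ionescu, S. Klainerman, *Rigidity results in general relativity: a review*, Surveys in
  Differential Geometry 20 (2015), 123–156, arXiv:1501.01587, §1 and §4 (Conjecture of
  Alexakis–Ionescu–Klainerman) (key `IonescuKlainerman2015`).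
* B. O'Neill, *Semi-Riemannian geometry with applications to relativity*, Academic Press 1983,
  Ch. 3, p. 68 (maximal geodesics), p. 69 (constant speed); Ch. 5, Lemma 5.26; Ch. 9, Lemma 26
  (conservation lemma) (key `ONeill1983`).
* P. T. Chruściel, J. L. Costa, *On uniqueness of stationary vacuum black holes*, Astérisque 321
  (2008), §2.1–2.2 (`M_ext = ⋃ₜ φₜ(Σ_ext)`, domain of outer communications) (key
  `ChruscielCosta2008`).
-/

noncomputable section

open Bundle Set Filter
open scoped Manifold ContDiff Topology

namespace Literature.Geometry.Lorentzian

namespace StationaryAFBlackHole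

universe u

variable (𝓑 : StationaryAFBlackHole.{u})

/-- The stationary asymptotically flat black hole `𝓑` **has a zero-energy null geodesic trapped
modulo the stationary flow**: there are a compact subset `S` of the domain of outer communications
`𝓑.doc = ⟨⟨M_ext⟩⟩`, a curve `γ : ℝ → M` and a set of parameters `s ⊆ ℝ` such that `γ` is a
**maximal** geodesic of the Levi-Civita connection of `𝓑.metric` with domain `s`
(`IsMaximalGeodesicOn`: `s` is an open interval, `γ` is a geodesic on `s` and admits no geodesic
extension to a larger open interval), `s` is non-empty, at every parameter `t ∈ s` the velocity
`γ̇(t)` is **null** (`g(γ̇, γ̇) = 0` and `γ̇ ≠ 0`) and of **zero energy** with respect to the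
stationary Killing field `T = 𝓑.killing` (`g(γ̇, T) = 0`), and the whole geodesic lies in the orbit
`⋃_σ φ_σ(S) = stationaryOrbit T S` of `S` under the flow of `T` — it is **trapped modulo `T`**.
These are the "trapped null geodesics perpendicular to the stationary Killing vector-field `T`" of
Ionescu–Klainerman 2015, §1 and §4, read modulo the stationary flow `φ_σ` of `T` (under which the
set of zero-energy null geodesics is invariant, `φ_σ` being isometries fixing `T`: trapping is
compactness of the projection to the space of `T`-orbits), whose absence
(`¬ 𝓑.HasZeroEnergyRayTrappedModFlow`, see `not_hasZeroEnergyRayTrappedModFlow_iff`) is the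
hypothesis of the Alexakis–Ionescu–Klainerman rigidity conjecture (loc. cit., §4) in the form
inlined by the routes `AnalyticityInvadesErgoregion` and `BeltLiouville` of `FinalStateConjecture`.
A DEFINITION (predicate on `𝓑`, explicit binder), under the standing Levi-Civita hypothesis
`[𝓑.metric.HasLeviCivita]` of `LeviCivita.lean`; compare the sibling `HasTrappedZeroEnergyRay`
(compactness in spacetime of a future half-ray), which it neither implies nor is implied by here.
[cite: IonescuKlainerman2015, §4 (Conjecture of Alexakis–Ionescu–Klainerman)] -/
def HasZeroEnergyRayTrappedModFlow (𝓑 : StationaryAFBlackHole.{u}) [𝓑.metric.HasLeviCivita] :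
    Prop :=
  ∃ S : Set 𝓑.carrier, IsCompact S ∧ S ⊆ 𝓑.doc ∧ ∃ (γ : ℝ → 𝓑.carrier) (s : Set ℝ),
    IsMaximalGeodesicOn 𝓑.metric.toPseudoRiemannianMetric.leviCivita γ s ∧ s.Nonempty ∧
      (∀ t ∈ s, 𝓑.metric.val (γ t) (velocity (𝓡 4) γ t) (velocity (𝓡 4) γ t) = 0 ∧
        velocity (𝓡 4) γ t ≠ 0 ∧
          𝓑.metric.val (γ t) (velocity (𝓡 4) γ t) (𝓑.killing (γ t)) = 0) ∧
      ∀ t ∈ s, γ t ∈ stationaryOrbit 𝓑.killing S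

/-! ### Zero-energy null vectors live in the closed ergoregion -/

/-- **A zero-energy null vector forces `0 ≤ g(T, T)`.** If at the point `x` there is a non-zero
vector `v` with `g(v, v) = 0` and `g(v, T(x)) = 0`, then the stationary Killing field is not
timelike at `x`: `0 ≤ g(T(x), T(x))`, i.e. `x` lies in the closed ergoregion. Indeed a causal
vector is never orthogonal to a timelike one (O'Neill 1983, Ch. 5, Lemma 5.26 and Cor. 5.27,
`LorentzianMetric.val_ne_zero_of_isTimelike_of_isCausal`). No connection is needed.
[cite: ONeill1983, Ch. 5, Lemma 5.26] -/
theorem killing_sq_nonneg_of_zeroEnergyNull {x : 𝓑.carrier} {v : TangentSpace (𝓡 4) x}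
    (hv : 𝓑.metric.val x v v = 0) (hv0 : v ≠ 0) (hT : 𝓑.metric.val x v (𝓑.killing x) = 0) :
    0 ≤ 𝓑.metric.val x (𝓑.killing x) (𝓑.killing x) := by
  by_contra h
  have htl : 𝓑.metric.IsTimelike (𝓑.killing x) := not_le.mp h
  have hc : 𝓑.metric.IsCausal v := ⟨le_of_eq hv, hv0⟩
  exact 𝓑.metric.val_ne_zero_of_isTimelike_of_isCausal htl hc
    ((𝓑.metric.symm x (𝓑.killing x) v).trans hT)

variable [𝓑.metric.HasLeviCivita]

/-! ### Unfolding lemmas -/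

/-- Unfolding lemma for `HasZeroEnergyRayTrappedModFlow` (positive shape: a compact `S ⊆ ⟨⟨M_ext⟩⟩`
and a maximal zero-energy null geodesic inside `⋃_σ φ_σ(S)`). [folklore] -/
lemma hasZeroEnergyRayTrappedModFlow_iff :
    𝓑.HasZeroEnergyRayTrappedModFlow ↔
      ∃ S : Set 𝓑.carrier, IsCompact S ∧ S ⊆ 𝓑.doc ∧ ∃ (γ : ℝ → 𝓑.carrier) (s : Set ℝ),
        IsMaximalGeodesicOn 𝓑.metric.toPseudoRiemannianMetric.leviCivita γ s ∧ s.Nonempty ∧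
          (∀ t ∈ s, 𝓑.metric.val (γ t) (velocity (𝓡 4) γ t) (velocity (𝓡 4) γ t) = 0 ∧
            velocity (𝓡 4) γ t ≠ 0 ∧
              𝓑.metric.val (γ t) (velocity (𝓡 4) γ t) (𝓑.killing (γ t)) = 0) ∧
          ∀ t ∈ s, γ t ∈ stationaryOrbit 𝓑.killing S :=
  Iff.rfl

/-- **No zero-energy null geodesic trapped modulo the stationary flow**, unfolded: for every compact
`S ⊆ ⟨⟨M_ext⟩⟩`, every maximal null geodesic of zero energy (non-empty domain) leaves the orbit
`⋃_σ φ_σ(S)` at some parameter — the hypothesis of the Alexakis–Ionescu–Klainerman conjecture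
(Ionescu–Klainerman 2015, §4) in the exact shape inlined in the items of the routes
`AnalyticityInvadesErgoregion` and `BeltLiouville` of `FinalStateConjecture`.
[cite: IonescuKlainerman2015, §4 (Conjecture of Alexakis–Ionescu–Klainerman)] -/
lemma not_hasZeroEnergyRayTrappedModFlow_iff :
    ¬ 𝓑.HasZeroEnergyRayTrappedModFlow ↔
      ∀ S : Set 𝓑.carrier, IsCompact S → S ⊆ 𝓑.doc → ∀ (γ : ℝ → 𝓑.carrier) (s : Set ℝ),
        IsMaximalGeodesicOn 𝓑.metric.toPseudoRiemannianMetric.leviCivita γ s → s.Nonempty →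
          (∀ t ∈ s, 𝓑.metric.val (γ t) (velocity (𝓡 4) γ t) (velocity (𝓡 4) γ t) = 0 ∧
            velocity (𝓡 4) γ t ≠ 0 ∧
              𝓑.metric.val (γ t) (velocity (𝓡 4) γ t) (𝓑.killing (γ t)) = 0) →
          ∃ t ∈ s, γ t ∉ stationaryOrbit 𝓑.killing S := by
  constructor
  · intro h S hS hSd γ s hγ hs hz
    by_contra hne
    push Not at hne
    exact h ⟨S, hS, hSd, γ, s, hγ, hs, hz, hne⟩
  · rintro h ⟨S, hS, hSd, γ, s, hγ, hs, hz, hin⟩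
    obtain ⟨t, ht, hnt⟩ := h S hS hSd γ s hγ hs hz
    exact hnt (hin t ht)

/-! ### Elementary consequences -/

/-- Enlarging the compact set is harmless: if the zero-energy null geodesic is trapped in
`⋃_σ φ_σ(S)` and `S ⊆ S'` with `S'` compact inside the d.o.c., it is trapped in `⋃_σ φ_σ(S')`
(`stationaryOrbit_mono`). Stated on witnesses, as the introduction rule it is used as. [folklore] -/
theorem HasZeroEnergyRayTrappedModFlow.mono_set {𝓑 : StationaryAFBlackHole.{u}}
    [𝓑.metric.HasLeviCivita] {S S' : Set 𝓑.carrier} (hSS' : S ⊆ S') (hS' : IsCompact S')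
    (hS'd : S' ⊆ 𝓑.doc) {γ : ℝ → 𝓑.carrier} {s : Set ℝ}
    (hγ : IsMaximalGeodesicOn 𝓑.metric.toPseudoRiemannianMetric.leviCivita γ s) (hs : s.Nonempty)
    (hz : ∀ t ∈ s, 𝓑.metric.val (γ t) (velocity (𝓡 4) γ t) (velocity (𝓡 4) γ t) = 0 ∧
      velocity (𝓡 4) γ t ≠ 0 ∧ 𝓑.metric.val (γ t) (velocity (𝓡 4) γ t) (𝓑.killing (γ t)) = 0)
    (hin : ∀ t ∈ s, γ t ∈ stationaryOrbit 𝓑.killing S) :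
    𝓑.HasZeroEnergyRayTrappedModFlow :=
  ⟨S', hS', hS'd, γ, s, hγ, hs, hz, fun t ht ↦ stationaryOrbit_mono 𝓑.killing hSS' (hin t ht)⟩

/-- A zero-energy null geodesic trapped modulo the flow meets `⋃_σ φ_σ(S)` for some `S ⊆ ⟨⟨M_ext⟩⟩`,
so `S`, and with it the domain of outer communications, is non-empty; in particular a stationary
black hole with empty d.o.c. has no such geodesic. [folklore] -/
lemma HasZeroEnergyRayTrappedModFlow.doc_nonempty {𝓑 : StationaryAFBlackHole.{u}}
    [𝓑.metric.HasLeviCivita] (h : 𝓑.HasZeroEnergyRayTrappedModFlow) : 𝓑.doc.Nonempty := by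
  obtain ⟨S, -, hSd, γ, s, -, ⟨t, ht⟩, -, hin⟩ := h
  obtain ⟨δ, -, hδ0, -⟩ := hin t ht
  exact ⟨δ 0, hSd hδ0⟩

/-- **A zero-energy ray trapped modulo the flow runs in the closed ergoregion**: if
`𝓑.HasZeroEnergyRayTrappedModFlow`, there is a point `x` in the `T`-orbit `⋃_σ φ_σ(S)` of a compact
subset `S` of the d.o.c. at which the stationary Killing field is not timelike, `0 ≤ g(T, T)` (any
point of the geodesic, by `killing_sq_nonneg_of_zeroEnergyNull`). Contrapositively, a stationary
black hole whose Killing field is timelike on the orbit of every compact subset of its d.o.c. has no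
zero-energy null geodesic trapped modulo the flow. O'Neill 1983, Ch. 5, Lemma 5.26.
[cite: ONeill1983, Ch. 5, Lemma 5.26] -/
theorem HasZeroEnergyRayTrappedModFlow.exists_killing_sq_nonneg {𝓑 : StationaryAFBlackHole.{u}}
    [𝓑.metric.HasLeviCivita] (h : 𝓑.HasZeroEnergyRayTrappedModFlow) :
    ∃ S : Set 𝓑.carrier, IsCompact S ∧ S ⊆ 𝓑.doc ∧ ∃ x ∈ stationaryOrbit 𝓑.killing S,
      0 ≤ 𝓑.metric.val x (𝓑.killing x) (𝓑.killing x) := by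
  obtain ⟨S, hS, hSd, γ, s, -, ⟨t, ht⟩, hz, hin⟩ := h
  obtain ⟨hv, hv0, hT⟩ := hz t ht
  exact ⟨S, hS, hSd, γ t, hin t ht, 𝓑.killing_sq_nonneg_of_zeroEnergyNull hv hv0 hT⟩

/-- **No ergoregion, no zero-energy null geodesic trapped modulo the flow**: if the stationary
Killing field is timelike at every point of the `T`-orbit of every compact subset of the d.o.c.
(e.g. timelike on the whole d.o.c., which is `φ_σ`-invariant), then
`¬ 𝓑.HasZeroEnergyRayTrappedModFlow` — there is not even a zero-energy null vector at such points
(`killing_sq_nonneg_of_zeroEnergyNull`; O'Neill 1983, Ch. 5, Lemma 5.26). This is the sanity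
check that the predicate is not vacuously true. [cite: ONeill1983, Ch. 5, Lemma 5.26] -/
theorem not_hasZeroEnergyRayTrappedModFlow_of_isTimelike
    (hT : ∀ S : Set 𝓑.carrier, IsCompact S → S ⊆ 𝓑.doc →
      ∀ x ∈ stationaryOrbit 𝓑.killing S, 𝓑.metric.IsTimelike (𝓑.killing x)) :
    ¬ 𝓑.HasZeroEnergyRayTrappedModFlow := fun h ↦ by
  obtain ⟨S, hS, hSd, x, hx, hx0⟩ := h.exists_killing_sq_nonneg
  exact not_lt.mpr hx0 (hT S hS hSd x hx)

/-! ### The initial-data criterion: nullness and zero energy propagate along the geodesic -/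

/-- **Zero energy at one parameter propagates along a maximal geodesic** (conservation lemma,
O'Neill 1983, Ch. 9, Lemma 26, for the stationary Killing field on the order-connected domain `s`
of the maximal geodesic, `killingEnergy_eq_of_isGeodesicOn`; the metric is symmetric, so the energy
may be written `g(γ̇, T)` as in the routes). [cite: ONeill1983, Ch. 9, Lemma 26] -/
theorem val_velocity_killing_eq_zero_of_isMaximalGeodesicOn {γ : ℝ → 𝓑.carrier} {s : Set ℝ}
    (hγ : IsMaximalGeodesicOn 𝓑.metric.toPseudoRiemannianMetric.leviCivita γ s) {t₀ : ℝ}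
    (ht₀ : t₀ ∈ s) (hT : 𝓑.metric.val (γ t₀) (velocity (𝓡 4) γ t₀) (𝓑.killing (γ t₀)) = 0)
    {t : ℝ} (ht : t ∈ s) :
    𝓑.metric.val (γ t) (velocity (𝓡 4) γ t) (𝓑.killing (γ t)) = 0 := by
  rw [𝓑.metric.symm] at hT ⊢
  exact (𝓑.killingEnergy_eq_of_isGeodesicOn hγ.2.1 hγ.2.2.1 ht ht₀).trans hT

/-- **Nullness of the velocity at one parameter propagates along a maximal geodesic** (geodesics
have constant speed, O'Neill 1983, Ch. 3, p. 69, on the order-connected domain `s`, with the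
compatibility of the Levi-Civita connection `isLeviCivita_leviCivita_holds`;
`val_velocity_eq_of_isGeodesicOn_of_ordConnected`). Non-vanishing of `γ̇`, the other half of
nullness, is not addressed here. [cite: ONeill1983, Ch. 3, p. 69] -/
theorem val_velocity_eq_zero_of_isMaximalGeodesicOn {γ : ℝ → 𝓑.carrier} {s : Set ℝ}
    (hγ : IsMaximalGeodesicOn 𝓑.metric.toPseudoRiemannianMetric.leviCivita γ s) {t₀ : ℝ}
    (ht₀ : t₀ ∈ s) (h0 : 𝓑.metric.val (γ t₀) (velocity (𝓡 4) γ t₀) (velocity (𝓡 4) γ t₀) = 0)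
    {t : ℝ} (ht : t ∈ s) :
    𝓑.metric.val (γ t) (velocity (𝓡 4) γ t) (velocity (𝓡 4) γ t) = 0 :=
  (𝓑.metric.toPseudoRiemannianMetric.val_velocity_eq_of_isGeodesicOn_of_ordConnected
    (PseudoRiemannianMetric.isLeviCivita_leviCivita_holds
      (g := 𝓑.metric.toPseudoRiemannianMetric)).2 hγ.2.1 hγ.2.2.1 ht ht₀).trans h0

/-- **Initial-data criterion for a zero-energy null geodesic trapped modulo the flow**: a maximal
geodesic `γ` of `𝓑.metric` with domain `s`, whose velocity is null and `T`-orthogonal at ONE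
parameter `t₀ ∈ s` and non-zero at all parameters, and which stays in the `T`-orbit of a compact
subset `S` of the d.o.c., witnesses `𝓑.HasZeroEnergyRayTrappedModFlow` (the two scalar conditions
propagate by `val_velocity_eq_zero_of_isMaximalGeodesicOn` and
`val_velocity_killing_eq_zero_of_isMaximalGeodesicOn`). [folklore] -/
theorem hasZeroEnergyRayTrappedModFlow_of_initial {S : Set 𝓑.carrier} (hS : IsCompact S)
    (hSd : S ⊆ 𝓑.doc) {γ : ℝ → 𝓑.carrier} {s : Set ℝ}
    (hγ : IsMaximalGeodesicOn 𝓑.metric.toPseudoRiemannianMetric.leviCivita γ s) {t₀ : ℝ}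
    (ht₀ : t₀ ∈ s)
    (hnull : 𝓑.metric.val (γ t₀) (velocity (𝓡 4) γ t₀) (velocity (𝓡 4) γ t₀) = 0)
    (hne : ∀ t ∈ s, velocity (𝓡 4) γ t ≠ 0)
    (hT : 𝓑.metric.val (γ t₀) (velocity (𝓡 4) γ t₀) (𝓑.killing (γ t₀)) = 0)
    (hin : ∀ t ∈ s, γ t ∈ stationaryOrbit 𝓑.killing S) :
    𝓑.HasZeroEnergyRayTrappedModFlow :=
  ⟨S, hS, hSd, γ, s, hγ, ⟨t₀, ht₀⟩, fun _ ht ↦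
    ⟨𝓑.val_velocity_eq_zero_of_isMaximalGeodesicOn hγ ht₀ hnull ht, hne _ ht,
      𝓑.val_velocity_killing_eq_zero_of_isMaximalGeodesicOn hγ ht₀ hT ht⟩, hin⟩

end StationaryAFBlackHole

end Literature.Geometry.Lorentzian

end
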